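import Summits.HodgeConjecture.HodgeConjecture.Theorems.VHCAbelianSchemesRoadRegimeLocalHygiene
import HarnessLib

/-!
# Road b02 (`VHCAbelianSchemesRoad`, D-0059) — THE LOCAL CRUX IS A STATEMENT ABOUT PAIRS `(X, w)`:
# `LocallyServedAt 𝒪 n p X w` and its constructors (the given pencil disappears from the stubs)

research route conditional on HC_CM; not a corollary; Q11.4-sentence-2 already refuted in dim ≥ 3.
(cell line of seat ab-andre-2: research route, not a corollary; conditional on HC_CM plus one named minimal statement.)

THEOREMS + one definition (a per-pair predicate with parameters; nothing asserted); no named fact, no sorry; `HC_CM` occurs nowhere.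
Seat ab-andre-2 gen 66 (follow-up of K-ADD 3/3; helper `--supports stmt-HodgeConjecture-20707`); the route, its `closes` glue, the
binders of record and the registered skeletons are NOT touched. VOCABULARY for the tenure planner's next skeleton over the LOCAL crux
(`LefAtExceptionalRegimeAtLocal`, `VHCAbelianSchemesRoadRegimeLocal.lean`), in the pattern of the served-fibre partition of
`VHCAbelianSchemesRoadServedFibre*.lean` (skeleton v3.3) — but simpler, because in the local form the AMBIENT PENCIL DROPS OUT:

* §1 `LocallyServedAt 𝒪 n p X w` — «the pair (X, w) is locally served»: there is a pencil `f'` (smooth projective family of relative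
  dimension `n`, quasi-projective total space, over a smooth irreducible affine curve) with a fibre `X'_{t'} ≅ X`, a global class `W'`
  restricting to `w` under that isomorphism, and finitely many `𝒪`-data on `f'` spanning `a•W' + Z'` (`a ≠ 0`, `Z'` fibrewise
  algebraic-Lefschetz) — VERBATIM the per-fibre clause of `AdmissibleRepresentativesLefAtDegLocal` with `𝒳_t ↦ X`, `W|_{𝒳_t} ↦ w`. The local
  graded crux at `(n, p)` IS «every fibre pair `(𝒳_t, W|_{𝒳_t})` of every pencil of the regime is locally served»
  (`admissibleRepresentativesLefAtDegLocal_iff_locallyServed`), and the local regime 2 likewise.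
* §2 constructors: transport along isomorphisms `X' ≅ X` (`LocallyServedAt.of_iso`); the LEFSCHETZ pair (`w` algebraic and Lefschetz on a
  smooth projective `X`: empty family on the constant pencil, `LocallyServedAt.of_lefschetz`); POINTWISE data on `X` (door respecting
  isomorphisms; `LocallyServedAt.of_pointwise`, = hygiene (h1)); and the ANCHOR TRANSPORT (`LocallyServedAt.of_anchor`): a pencil `f'` from an
  anchor fibre `X'_{s₁} ≅ Y` to `X'_{t'} ≅ X`, pointwise `𝒪`-data ON `Y`, global fibrewise-Hodge classes on `𝒳'` extending the anchor's carried
  classes, and a global `W'` through `w` in their span modulo a fibrewise algebraic-Lefschetz `Z'` — the shape in which the lanes serve the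
  `(6,3)` Weil cells (print carrier + one mover at a pinned anchor, André/Deligne pencil inside the Shimura variety; nothing of that is
  claimed here).

So a skeleton over the local crux can be cut by CLASSES OF PAIRS — e.g. at `(6, 3)`: Lefschetz pairs (free), Weil-type pairs (anchor transport:
span data at pinned anchors + reachability), the residual pairs (exceptional `(3,3)`-classes on abelian sixfolds not of Weil type) — with no
served-fibre bookkeeping on the given pencil. NOT claimed: that any pair is served; anything about `HC_CM`.
References: [Hartshorne1977] II.3; [vanGeemen1994HodgeAV] §2.4, Thm. 4.11; [Bloch1972Semiregularity] Rem. (7.5); [BuchweitzFlenner2003] §5 Thm. 5.1;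
[Markman2025SecantWeil] Thm. 1.4.1, Thm. 1.5.1; [Andre1996Motifs] §6.3; [GrothendieckTopology1969] §1.
-/

noncomputable section

open CategoryTheory CategoryTheory.Limits AlgebraicGeometry Topology MonoidalCategory CartesianMonoidalCategory

namespace Summit.HodgeConjecture.HodgeConjecture.Ring2.SemiregularRepresentatives

set_option linter.dupNamespace false -- the cell's namespace repeats the summit name, as in every `Ring2*` file

open Literature.AlgebraicGeometry Literature.AlgebraicGeometry.Motives Literature.AlgebraicGeometry.HodgeTheory
open Literature.AlgebraicTopology.SingularHomology
open Literature.Barriers.HodgeConjecture (divisorClassesSpan)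
open Summit.Ventures.HSemireg (ObjClass)

/-! ## §1 The per-pair predicate and the local crux as a statement about fibre pairs -/

/-- **`LocallyServedAt 𝒪 n p X w` — the pair `(X, w)` is LOCALLY SERVED for the door `𝒪` at `(n, p)`** (PREDICATE with parameters, nothing
asserted): there are a pencil `f' : 𝒳' ⟶ S'` — smooth projective family of relative dimension `n`, quasi-projective total space, over a smooth
irreducible affine curve — a fibre `e : X'_{t'} ≅ X`, a global class `W'` on `𝒳'` with `e^* w = W'|_{X'_{t'}}`, finitely many (`k ≥ 0`)
`𝒪`-admissible data on `f'` (each at its own fibre `s i`, with pinned degrees `I i ∋ p`, classes `κ i`, global fibrewise-Hodge extensions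
`V i`), a scalar `a ≠ 0` and a fibrewise algebraic-Lefschetz global `Z'` with `a•W' + Z' = ∑ i, c i • V i p`. VERBATIM the per-fibre clause of
`AdmissibleRepresentativesLefAtDegLocal 𝒪 n p` at `(𝒳_t, W|_{𝒳_t}) ↦ (X, w)`. [cite: vanGeemen1994HodgeAV, §2.4 and Thm. 4.11]
[cite: BuchweitzFlenner2003, §5 Thm. 5.1] [cite: Markman2025SecantWeil, Thm. 1.4.1 and Thm. 1.5.1] -/
def LocallyServedAt (𝒪 : ObjClass) (n p : ℕ) (X : SchemeOver ℂ) (w : complexBetti X (2 * p)) : Prop :=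
  ∃ (𝒳' S' : SchemeOver ℂ) (f' : 𝒳' ⟶ S') (t' : ComplexPoints S') (e : fiberOver f' t' ≅ X)
    (W' : complexBetti 𝒳' (2 * p))
    (k : ℕ) (s : Fin k → ComplexPoints S') (I : Fin k → Finset ℕ)
    (κ : (i : Fin k) → (q : ℕ) → complexBetti (fiberOver f' (s i)) (2 * q))
    (V : Fin k → (q : ℕ) → complexBetti 𝒳' (2 * q)) (c : Fin k → ℂ) (a : ℂ) (Z : complexBetti 𝒳' (2 * p)),
    IsSmoothProjectiveFamily f' n ∧ IsQuasiProjectiveOver 𝒳' ∧ IrreducibleSpace S'.left ∧ IsAffine S'.left ∧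
    AlgebraicGeometry.Smooth S'.hom ∧ topologicalKrullDim S'.left = 1 ∧
    complexBetti.map e.hom (2 * p) w = complexBetti.map (fiberι f' t') (2 * p) W' ∧
    (∀ i, p ∈ I i ∧ 𝒪 n (fiberOver f' (s i)) (I i) (κ i) ∧
      (∀ q ∈ I i, κ i q = complexBetti.map (fiberι f' (s i)) (2 * q) (V i q)) ∧
      (∀ q ∈ I i, ∀ u : ComplexPoints S',
        IsOfHodgeType n (fiberOver f' u) (2 * q) q q (complexBetti.map (fiberι f' u) (2 * q) (V i q)))) ∧
    a ≠ 0 ∧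
    (∀ u : ComplexPoints S',
      complexBetti.map (fiberι f' u) (2 * p) Z ∈ algebraicClasses (fiberOver f' u) p ∧
      complexBetti.map (fiberι f' u) (2 * p) Z ∈ divisorClassesSpan (fiberOver f' u) n p) ∧
    a • W' + Z = ∑ i, c i • V i p

variable {𝒪 𝒪' : ObjClass} {n p : ℕ}

/-- **The local graded crux at `(n, p)` ⟺ every fibre pair of every pencil of the regime is locally served** (definitional).
[cite: vanGeemen1994HodgeAV, §2.4] -/
theorem admissibleRepresentativesLefAtDegLocal_iff_locallyServed :
    AdmissibleRepresentativesLefAtDegLocal 𝒪 n p ↔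
      ∀ ⦃𝒳 S : SchemeOver ℂ⦄ (f : 𝒳 ⟶ S), IsSmoothProjectiveFamily f n → IsQuasiProjectiveOver 𝒳 →
        IrreducibleSpace S.left → IsAffine S.left → AlgebraicGeometry.Smooth S.hom → topologicalKrullDim S.left = 1 →
        (∀ s : ComplexPoints S, ∃ A' : AbelianVariety ℂ, A'.dim = n ∧ Nonempty (A'.X ≅ fiberOver f s)) →
        (∃ e : S ⟶ 𝒳, e ≫ f = 𝟙 S) →
        ∀ (W : complexBetti 𝒳 (2 * p)),
          (∀ s : ComplexPoints S, IsRationalClass (complexBetti.map (fiberι f s) (2 * p) W) ∧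
            IsOfHodgeType n (fiberOver f s) (2 * p) p p (complexBetti.map (fiberι f s) (2 * p) W)) →
          ∀ s₀ : ComplexPoints S,
            complexBetti.map (fiberι f s₀) (2 * p) W ∈ algebraicClasses (fiberOver f s₀) p →
            ∀ t : ComplexPoints S, LocallyServedAt 𝒪 n p (fiberOver f t) (complexBetti.map (fiberι f t) (2 * p) W) :=
  Iff.rfl

/-- **Local regime 2 at `(n, p)` ⟺ every fibre pair of every EXCEPTIONAL pencil of the regime is locally served** (definitional).
[cite: vanGeemen1994HodgeAV, §2.4 and Thm. 4.11] -/
theorem lefAtExceptionalRegimeAtLocal_iff_locallyServed :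
    LefAtExceptionalRegimeAtLocal 𝒪 n p ↔
      ∀ ⦃𝒳 S : SchemeOver ℂ⦄ (f : 𝒳 ⟶ S), IsSmoothProjectiveFamily f n → IsQuasiProjectiveOver 𝒳 →
        IrreducibleSpace S.left → IsAffine S.left → AlgebraicGeometry.Smooth S.hom → topologicalKrullDim S.left = 1 →
        (∀ s : ComplexPoints S, ∃ A' : AbelianVariety ℂ, A'.dim = n ∧ Nonempty (A'.X ≅ fiberOver f s)) →
        (∃ e : S ⟶ 𝒳, e ≫ f = 𝟙 S) →
        ∀ (W : complexBetti 𝒳 (2 * p)),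
          (∀ s : ComplexPoints S, IsRationalClass (complexBetti.map (fiberι f s) (2 * p) W) ∧
            IsOfHodgeType n (fiberOver f s) (2 * p) p p (complexBetti.map (fiberι f s) (2 * p) W)) →
          ∀ s₀ : ComplexPoints S,
            complexBetti.map (fiberι f s₀) (2 * p) W ∈ algebraicClasses (fiberOver f s₀) p →
            (¬ ∀ s : ComplexPoints S,
              complexBetti.map (fiberι f s) (2 * p) W ∈ algebraicClasses (fiberOver f s) p ∧
              complexBetti.map (fiberι f s) (2 * p) W ∈ divisorClassesSpan (fiberOver f s) n p) →
            ∀ t : ComplexPoints S, LocallyServedAt 𝒪 n p (fiberOver f t) (complexBetti.map (fiberι f t) (2 * p) W) :=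
  Iff.rfl

/-- **A class of pairs that contains every fibre pair gives the local graded crux**: if EVERY pair `(X, w)` with `X` isomorphic to an
abelian `n`-fold and `w` a rational `(p,p)`-class is locally served, then `AdmissibleRepresentativesLefAtDegLocal 𝒪 n p` (the ambient pencil,
its section and the algebraic fibre `s₀` are not used — the per-pair statement is STRONGER). [cite: vanGeemen1994HodgeAV, §2.4] -/
theorem admissibleRepresentativesLefAtDegLocal_of_forall_pairs
    (h : ∀ (X : SchemeOver ℂ), (∃ A' : AbelianVariety ℂ, A'.dim = n ∧ Nonempty (A'.X ≅ X)) →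
      ∀ w : complexBetti X (2 * p), IsRationalClass w → IsOfHodgeType n X (2 * p) p p w → LocallyServedAt 𝒪 n p X w) :
    AdmissibleRepresentativesLefAtDegLocal 𝒪 n p :=
  fun _ _ f _ _ _ _ _ _ habel _ _ hW _ _ t => h (fiberOver f t) (habel t) _ (hW t).1 (hW t).2

/-! ## §2 Constructors: isomorphisms, the Lefschetz pair, pointwise data, the anchor transport -/

variable {X : SchemeOver ℂ}

/-- **Transport along an isomorphism**: if `(X, w)` is locally served and `e : X₁ ≅ X`, then `(X₁, e^* w)` is (compose the fibre
isomorphism). [cite: GrothendieckTopology1969, §1] -/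
theorem LocallyServedAt.of_iso {w : complexBetti X (2 * p)} (h : LocallyServedAt 𝒪 n p X w) {X₁ : SchemeOver ℂ} (e : X₁ ≅ X) :
    LocallyServedAt 𝒪 n p X₁ (complexBetti.map e.hom (2 * p) w) := by
  obtain ⟨𝒳', S', f', t', e', W', k, s, I, κ, V, c, a, Z, hf', h𝒳', hirr', haff', hsm', hdim', hWe, hdat, ha, hZ, hsum⟩ := h
  refine ⟨𝒳', S', f', t', e' ≪≫ e.symm, W', k, s, I, κ, V, c, a, Z, hf', h𝒳', hirr', haff', hsm', hdim', ?_, hdat, ha, hZ, hsum⟩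
  rw [← hWe, Iso.trans_hom, Iso.symm_hom, complexBetti.map_comp]
  change complexBetti.map e'.hom (2 * p) (complexBetti.map e.inv (2 * p) (complexBetti.map e.hom (2 * p) w)) = _
  rw [e.complexBetti_map_inv_map_hom]

/-- **Monotonicity in the door.** [folklore] -/
theorem LocallyServedAt.mono (h𝒪 : ∀ n X₀ I κ, 𝒪 n X₀ I κ → 𝒪' n X₀ I κ) {w : complexBetti X (2 * p)}
    (h : LocallyServedAt 𝒪 n p X w) : LocallyServedAt 𝒪' n p X w := by
  obtain ⟨𝒳', S', f', t', e', W', k, s, I, κ, V, c, a, Z, hf', h𝒳', hirr', haff', hsm', hdim', hWe, hdat, ha, hZ, hsum⟩ := h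
  exact ⟨𝒳', S', f', t', e', W', k, s, I, κ, V, c, a, Z, hf', h𝒳', hirr', haff', hsm', hdim', hWe,
    fun i => ⟨(hdat i).1, h𝒪 _ _ _ _ (hdat i).2.1, (hdat i).2.2.1, (hdat i).2.2.2⟩, ha, hZ, hsum⟩

/-- **POINTWISE data on `X` serve `(X, w)`** (door respecting isomorphisms; the constant pencil `X × 𝔸¹`, hygiene (h1)): finitely many
`𝒪`-data `(I i, κ i)` ON the smooth projective `n`-fold `X`, `κ i q` of type `(q,q)`, `p ∈ I i`, with `a•w + z = ∑ i, c i • κ i p`, `a ≠ 0`,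
`z` algebraic-Lefschetz. [cite: Hartshorne1977, II.3 (p. 89)] [cite: Bloch1972Semiregularity, Remark (7.5)] -/
theorem LocallyServedAt.of_pointwise
    (h𝒪 : ∀ (n : ℕ) ⦃Y Y' : SchemeOver ℂ⦄ (e : Y' ≅ Y) (I : Finset ℕ) (κ : (q : ℕ) → complexBetti Y (2 * q)),
      𝒪 n Y I κ → 𝒪 n Y' I (fun q ↦ complexBetti.map e.hom (2 * q) (κ q)))
    (hX : IsSmoothProjective n X) (w : complexBetti X (2 * p))
    {k : ℕ} {I : Fin k → Finset ℕ} {κ : Fin k → (q : ℕ) → complexBetti X (2 * q)} {c : Fin k → ℂ} {a : ℂ} {z : complexBetti X (2 * p)}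
    (hdat : ∀ i, p ∈ I i ∧ 𝒪 n X (I i) (κ i) ∧ ∀ q ∈ I i, IsOfHodgeType n X (2 * q) q q (κ i q))
    (ha : a ≠ 0) (hz : z ∈ algebraicClasses X p ∧ z ∈ divisorClassesSpan X n p) (hsum : a • w + z = ∑ i, c i • κ i p) :
    LocallyServedAt 𝒪 n p X w := by
  haveI : IrreducibleSpace (specOver ℂ (MvPolynomial (Fin 1) ℂ)).left := irreducibleSpace_affineLine_left
  haveI : IsAffine (specOver ℂ (MvPolynomial (Fin 1) ℂ)).left := isAffine_affineLine_left
  obtain ⟨s₀⟩ := nonempty_complexPoints_affineLine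
  have hf' : IsSmoothProjectiveFamily (snd X (specOver ℂ (MvPolynomial (Fin 1) ℂ))) n := isSmoothProjectiveFamily_snd hX _
  have h𝒳' : IsQuasiProjectiveOver (X ⊗ specOver ℂ (MvPolynomial (Fin 1) ℂ)) :=
    isQuasiProjectiveOver_tensor_of_isProjectiveOver hX.isProjectiveOver isQuasiProjectiveOver_affineLine
  have hres := fun (u : ComplexPoints (specOver ℂ (MvPolynomial (Fin 1) ℂ))) (k : ℕ) (x : complexBetti X k) ↦
    map_fiberι_map_fst_eq (X := X) u k x
  refine ⟨X ⊗ specOver ℂ (MvPolynomial (Fin 1) ℂ), specOver ℂ (MvPolynomial (Fin 1) ℂ), snd X _, s₀, (sliceFiberIso X s₀).symm,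
    complexBetti.map (fst X _) (2 * p) w, k, fun _ ↦ s₀, I,
    fun i q ↦ complexBetti.map (sliceFiberIso X s₀).symm.hom (2 * q) (κ i q),
    fun i q ↦ complexBetti.map (fst X _) (2 * q) (κ i q), c, a, complexBetti.map (fst X _) (2 * p) z,
    hf', h𝒳', irreducibleSpace_affineLine_left, isAffine_affineLine_left, smooth_affineLine_hom,
    topologicalKrullDim_affineLine_left, ?_,
    fun i ↦ ⟨(hdat i).1, h𝒪 n (sliceFiberIso X s₀).symm (I i) (κ i) (hdat i).2.1, fun q _ ↦ ?_, fun q hq u ↦ ?_⟩,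
    ha, fun u ↦ ⟨?_, ?_⟩, ?_⟩
  · rw [hres s₀, Iso.symm_hom]
  · rw [hres s₀, Iso.symm_hom]
  · rw [hres u]
    exact (isOfHodgeType_map_iff_of_iso (sliceFiberIso X u).symm).2 ((hdat i).2.2 q hq)
  · rw [hres u]
    exact (mem_algebraicClasses_map_iff_of_iso (sliceFiberIso X u).symm).2 hz.1
  · rw [hres u]
    exact map_mem_divisorClassesSpan (hf'.isSmoothProjective u) hX (sliceFiberIso X u).inv hz.2
  · have h := congrArg (complexBetti.map (fst X (specOver ℂ (MvPolynomial (Fin 1) ℂ))) (2 * p)) hsum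
    rw [map_add, map_smul, map_sum] at h
    simp_rw [map_smul] at h
    simpa only using h

/-- **The LEFSCHETZ pair is served datum-free**: `w` algebraic and Lefschetz on the smooth projective `n`-fold `X` (empty family on the
constant pencil `X × 𝔸¹`, `a := 1`, `Z' := −pr₁^* w`; no hypothesis on the door). [cite: vanGeemen1994HodgeAV, §2.4] [cite: Hartshorne1977, II.3 (p. 89)] -/
theorem LocallyServedAt.of_lefschetz (hX : IsSmoothProjective n X) (w : complexBetti X (2 * p))
    (hw : w ∈ algebraicClasses X p ∧ w ∈ divisorClassesSpan X n p) : LocallyServedAt 𝒪 n p X w := by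
  haveI : IrreducibleSpace (specOver ℂ (MvPolynomial (Fin 1) ℂ)).left := irreducibleSpace_affineLine_left
  haveI : IsAffine (specOver ℂ (MvPolynomial (Fin 1) ℂ)).left := isAffine_affineLine_left
  obtain ⟨s₀⟩ := nonempty_complexPoints_affineLine
  have hf' : IsSmoothProjectiveFamily (snd X (specOver ℂ (MvPolynomial (Fin 1) ℂ))) n := isSmoothProjectiveFamily_snd hX _
  have h𝒳' : IsQuasiProjectiveOver (X ⊗ specOver ℂ (MvPolynomial (Fin 1) ℂ)) :=
    isQuasiProjectiveOver_tensor_of_isProjectiveOver hX.isProjectiveOver isQuasiProjectiveOver_affineLine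
  have hres := fun (u : ComplexPoints (specOver ℂ (MvPolynomial (Fin 1) ℂ))) (k : ℕ) (x : complexBetti X k) ↦
    map_fiberι_map_fst_eq (X := X) u k x
  refine ⟨X ⊗ specOver ℂ (MvPolynomial (Fin 1) ℂ), specOver ℂ (MvPolynomial (Fin 1) ℂ), snd X _, s₀, (sliceFiberIso X s₀).symm,
    complexBetti.map (fst X _) (2 * p) w, 0, Fin.elim0, Fin.elim0, fun i ↦ i.elim0, Fin.elim0, Fin.elim0, 1,
    -complexBetti.map (fst X _) (2 * p) w,
    hf', h𝒳', irreducibleSpace_affineLine_left, isAffine_affineLine_left, smooth_affineLine_hom,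
    topologicalKrullDim_affineLine_left, ?_, fun i ↦ i.elim0, one_ne_zero, fun u ↦ ⟨?_, ?_⟩, ?_⟩
  · rw [hres s₀, Iso.symm_hom]
  · rw [map_neg, hres u]
    exact Submodule.neg_mem _ ((mem_algebraicClasses_map_iff_of_iso (sliceFiberIso X u).symm).2 hw.1)
  · rw [map_neg, hres u]
    exact Submodule.neg_mem _ (map_mem_divisorClassesSpan (hf'.isSmoothProjective u) hX (sliceFiberIso X u).inv hw.2)
  · rw [one_smul, add_neg_cancel, Fin.sum_univ_zero]

/-- **ANCHOR TRANSPORT serves `(X, w)`** — the shape in which a pencil of our choice through an anchor serves a pair: a pencil `f'`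
(binders as in `LocallyServedAt`) with an anchor fibre `eY : X'_{s₁} ≅ Y` and a fibre `eX : X'_{t'} ≅ X`; finitely many `𝒪`-data `(I i, κ i)`
ON `Y` (door respecting isomorphisms); global classes `V i q` on `𝒳'`, fibrewise `(q,q)`, EXTENDING the anchor's carried classes
(`V i q|_{X'_{s₁}} = eY^* (κ i q)` … read through `eY`); a global `W'` with `eX^* w = W'|_{X'_{t'}}`, `a ≠ 0` and a fibrewise algebraic-Lefschetz
`Z'` with `a•W' + Z' = ∑ i, c i • V i p`. [cite: Markman2025SecantWeil, Thm. 1.4.1 and Thm. 1.5.1] [cite: Andre1996Motifs, §6.3]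
[cite: Bloch1972Semiregularity, Remark (7.5)] -/
theorem LocallyServedAt.of_anchor
    (h𝒪 : ∀ (n : ℕ) ⦃Y Y' : SchemeOver ℂ⦄ (e : Y' ≅ Y) (I : Finset ℕ) (κ : (q : ℕ) → complexBetti Y (2 * q)),
      𝒪 n Y I κ → 𝒪 n Y' I (fun q ↦ complexBetti.map e.hom (2 * q) (κ q)))
    (w : complexBetti X (2 * p)) {𝒳' S' : SchemeOver ℂ} (f' : 𝒳' ⟶ S') (hf' : IsSmoothProjectiveFamily f' n)
    (h𝒳' : IsQuasiProjectiveOver 𝒳') (hirr' : IrreducibleSpace S'.left) (haff' : IsAffine S'.left)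
    (hsm' : AlgebraicGeometry.Smooth S'.hom) (hdim' : topologicalKrullDim S'.left = 1)
    {Y : SchemeOver ℂ} {s₁ t' : ComplexPoints S'} (eY : fiberOver f' s₁ ≅ Y) (eX : fiberOver f' t' ≅ X)
    {k : ℕ} {I : Fin k → Finset ℕ} {κ : Fin k → (q : ℕ) → complexBetti Y (2 * q)}
    (hdat : ∀ i, p ∈ I i ∧ 𝒪 n Y (I i) (κ i))
    {V : Fin k → (q : ℕ) → complexBetti 𝒳' (2 * q)}
    (hV : ∀ i, ∀ q ∈ I i, complexBetti.map (fiberι f' s₁) (2 * q) (V i q) = complexBetti.map eY.hom (2 * q) (κ i q))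
    (hVH : ∀ i, ∀ q ∈ I i, ∀ u : ComplexPoints S',
      IsOfHodgeType n (fiberOver f' u) (2 * q) q q (complexBetti.map (fiberι f' u) (2 * q) (V i q)))
    {W' : complexBetti 𝒳' (2 * p)} (hW' : complexBetti.map eX.hom (2 * p) w = complexBetti.map (fiberι f' t') (2 * p) W')
    {c : Fin k → ℂ} {a : ℂ} (ha : a ≠ 0) {Z : complexBetti 𝒳' (2 * p)}
    (hZ : ∀ u : ComplexPoints S',
      complexBetti.map (fiberι f' u) (2 * p) Z ∈ algebraicClasses (fiberOver f' u) p ∧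
      complexBetti.map (fiberι f' u) (2 * p) Z ∈ divisorClassesSpan (fiberOver f' u) n p)
    (hsum : a • W' + Z = ∑ i, c i • V i p) :
    LocallyServedAt 𝒪 n p X w :=
  ⟨𝒳', S', f', t', eX, W', k, fun _ ↦ s₁, I, fun i q ↦ complexBetti.map eY.hom (2 * q) (κ i q), V, c, a, Z,
    hf', h𝒳', hirr', haff', hsm', hdim', hW',
    fun i ↦ ⟨(hdat i).1, h𝒪 n eY (I i) (κ i) (hdat i).2, fun q hq ↦ (hV i q hq).symm, hVH i⟩, ha, hZ, hsum⟩

/-! ## §3 Composition by a PARTITION OF THE PAIRS (appended, ab-andre-2 gen 66; helper for the deciding crux item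
stmt-HodgeConjecture-23176 `SemiregularSheafRepresentativesTwPrimeAtDiagLocal`, skeleton v3.5.x of LEAD 160) -/

/-- The local graded crux at `(n, p)` gives local regime 2 at `(n, p)` (drop the «not Lefschetz everywhere» hypothesis; `k = 0` is allowed
on both sides, so no case split is needed — contrast the additive twins). [folklore] -/
theorem lefAtExceptionalRegimeAtLocal_of_admissibleRepresentativesLefAtDegLocal (h : AdmissibleRepresentativesLefAtDegLocal 𝒪 n p) :
    LefAtExceptionalRegimeAtLocal 𝒪 n p :=
  fun _ _ f hf h𝒳 hirr haff hsm hdim habel he W hW s₀ hs₀ _ t => h f hf h𝒳 hirr haff hsm hdim habel he W hW s₀ hs₀ t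

/-- **COMPOSITION BY A PARTITION OF THE PAIRS** (the skeleton shape over the local crux): fix a predicate `𝔓` on pairs `(X, w)` — e.g.
«`X` is of Weil type for an imaginary-quadratic `K` and `w ∈ W_K(X) ⊕ ℚθ³`» at `(6, 3)`. IF every `𝔓`-pair with `X` isomorphic to an abelian
`n`-fold and `w` a rational `(p,p)`-class is locally served (stub «W», served in practice through `LocallyServedAt.of_anchor`), AND every
NON-`𝔓` pair whose class is NOT algebraic-Lefschetz is locally served (stub «R», the honest residual list), THEN the local graded crux at
`(n, p)` holds — the Lefschetz pairs being free (`LocallyServedAt.of_lefschetz`, datum-free, no door hypothesis). The given pencil, its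
section and the algebraic fibre `s₀` play no role. [cite: vanGeemen1994HodgeAV, §2.4 and Thm. 4.11] [cite: Markman2025SecantWeil, Thm. 1.5.1] -/
theorem admissibleRepresentativesLefAtDegLocal_of_partition (𝔓 : ∀ X : SchemeOver ℂ, complexBetti X (2 * p) → Prop)
    (hW : ∀ (X : SchemeOver ℂ), (∃ A' : AbelianVariety ℂ, A'.dim = n ∧ Nonempty (A'.X ≅ X)) →
      ∀ w : complexBetti X (2 * p), IsRationalClass w → IsOfHodgeType n X (2 * p) p p w → 𝔓 X w → LocallyServedAt 𝒪 n p X w)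
    (hR : ∀ (X : SchemeOver ℂ), (∃ A' : AbelianVariety ℂ, A'.dim = n ∧ Nonempty (A'.X ≅ X)) →
      ∀ w : complexBetti X (2 * p), IsRationalClass w → IsOfHodgeType n X (2 * p) p p w →
        ¬ (w ∈ algebraicClasses X p ∧ w ∈ divisorClassesSpan X n p) → ¬ 𝔓 X w → LocallyServedAt 𝒪 n p X w) :
    AdmissibleRepresentativesLefAtDegLocal 𝒪 n p := by
  refine admissibleRepresentativesLefAtDegLocal_of_forall_pairs fun X hX w hwQ hwH ↦ ?_
  by_cases hL : w ∈ algebraicClasses X p ∧ w ∈ divisorClassesSpan X n p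
  · obtain ⟨A, hA, ⟨eA⟩⟩ := hX
    have hAX : IsSmoothProjective n A.X := hA ▸ AbelianVariety.isSmoothProjective_holds (A := A)
    exact LocallyServedAt.of_lefschetz (hAX.of_iso eA) w hL
  by_cases hP : 𝔓 X w
  · exact hW X hX w hwQ hwH hP
  · exact hR X hX w hwQ hwH hL hP

/-- **The same composition for LOCAL REGIME 2 at `(n, p)`** (the shape of the route's deciding crux `SemiregularSheafRepresentativesTwPrimeAtDiagLocal`
cell by cell: instantiate `𝒪 := twistedReflexiveClass C AdmTw'`, `(n, p) := (6, 3)` per `C`). [cite: vanGeemen1994HodgeAV, §2.4 and Thm. 4.11]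
[cite: Markman2025SecantWeil, Thm. 1.5.1] -/
theorem lefAtExceptionalRegimeAtLocal_of_partition (𝔓 : ∀ X : SchemeOver ℂ, complexBetti X (2 * p) → Prop)
    (hW : ∀ (X : SchemeOver ℂ), (∃ A' : AbelianVariety ℂ, A'.dim = n ∧ Nonempty (A'.X ≅ X)) →
      ∀ w : complexBetti X (2 * p), IsRationalClass w → IsOfHodgeType n X (2 * p) p p w → 𝔓 X w → LocallyServedAt 𝒪 n p X w)
    (hR : ∀ (X : SchemeOver ℂ), (∃ A' : AbelianVariety ℂ, A'.dim = n ∧ Nonempty (A'.X ≅ X)) →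
      ∀ w : complexBetti X (2 * p), IsRationalClass w → IsOfHodgeType n X (2 * p) p p w →
        ¬ (w ∈ algebraicClasses X p ∧ w ∈ divisorClassesSpan X n p) → ¬ 𝔓 X w → LocallyServedAt 𝒪 n p X w) :
    LefAtExceptionalRegimeAtLocal 𝒪 n p :=
  lefAtExceptionalRegimeAtLocal_of_admissibleRepresentativesLefAtDegLocal
    (admissibleRepresentativesLefAtDegLocal_of_partition 𝔓 hW hR)

/-- **Without a distinguished class of pairs**: if every pair whose class is NOT algebraic-Lefschetz is locally served, local regime 2 holds
(the one-stub shape; `𝔓 := ⊥`). [cite: vanGeemen1994HodgeAV, §2.4] -/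
theorem lefAtExceptionalRegimeAtLocal_of_exceptional_pairs
    (hR : ∀ (X : SchemeOver ℂ), (∃ A' : AbelianVariety ℂ, A'.dim = n ∧ Nonempty (A'.X ≅ X)) →
      ∀ w : complexBetti X (2 * p), IsRationalClass w → IsOfHodgeType n X (2 * p) p p w →
        ¬ (w ∈ algebraicClasses X p ∧ w ∈ divisorClassesSpan X n p) → LocallyServedAt 𝒪 n p X w) :
    LefAtExceptionalRegimeAtLocal 𝒪 n p :=
  lefAtExceptionalRegimeAtLocal_of_partition (fun _ _ ↦ False) (fun _ _ _ _ _ h ↦ h.elim) (fun X hX w hwQ hwH hL _ ↦ hR X hX w hwQ hwH hL)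

end Summit.HodgeConjecture.HodgeConjecture.Ring2.SemiregularRepresentatives

end
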